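import Summits.AtomisticToContinuum.Crystallization.Theorems.ChargedEnergyGap.Negative.FarCopies

/-!
# `ChargedPeriodicIsOptimal` (stmt-AtomisticToContinuum-2913), helpers I: shell sums and packing

Elementary metric-combinatorial lemmas for the excision argument proving item 2913
(`PricedLinkCensus.ChargedPeriodicIsOptimal`):

* `sum_inv_pow_five_le` — for an `r`-separated finite configuration of `ℝ³`,
  `∑_{k ≠ i} |xᵢ − x_k|⁻⁵ ≤ 250 r⁻⁵` (the shell argument of the tree's `sum_inv_pow_six_le`
  with exponent `5`), whence the FAR sixth-power sum decays:
  `∑_{k : |xᵢ − x_k| ≥ T} |xᵢ − x_k|⁻⁶ ≤ 250 r⁻⁵ / T` (`sum_inv_pow_six_far_le`);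
* `exists_separated_net` — a finite family of points has a `D`-separated sub-family that is a
  `D`-net of it (a separated subset of maximal cardinality), and the counting consequence
  `card_le_card_net_mul` (`#G ≤ #net · C` when `D`-balls hold at most `C` members of `G`);
* `card_ball_le_of_separated` — in an `r`-separated configuration of `ℝ³` at most
  `(2D/r + 1)³` particles lie within `D` of a given particle (tree packing bound
  `card_le_of_separated_of_dist_le`).

All `[folklore]`.
-/

noncomputable section

namespace Summit.AtomisticToContinuum.Crystallization.Theorems.ChargedPeriodicOptimal

open Literature.MathematicalPhysics.StatisticalMechanics
open Summit.AtomisticToContinuum.Crystallization.Theorems.ChargedEnergyGapNegative (E3)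
open scoped BigOperators
open Metric

/-! ## Shell sums with exponent five, and the far sixth-power sum -/

/-- **Shell sum, exponent five.** If all mutual distances in the configuration `x` (in `ℝ³`)
are `≥ r > 0`, then `∑_{k ≠ i} |xᵢ − x_k|⁻⁵ ≤ 250 · r⁻⁵`: the shell `⌊|xᵢ − x_k| / r⌋ = b`
(`b ≥ 1`) contains at most `(2b + 3)³ ≤ 125 b³` particles by the packing bound, each
contributing `≤ (b r)⁻⁵`, and `∑_{b ≥ 1} b⁻² ≤ 2` (the proof of the tree's
`sum_inv_pow_six_le`, one power lower). [folklore] -/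
theorem sum_inv_pow_five_le {N : ℕ} (x : Fin N → E3) {r : ℝ} (hr : 0 < r)
    (hsep : ∀ k l, k ≠ l → r ≤ dist (x k) (x l)) (i : Fin N) :
    ∑ k ∈ Finset.univ.erase i, (dist (x i) (x k))⁻¹ ^ 5 ≤ 250 * r⁻¹ ^ 5 := by
  set s := Finset.univ.erase i with hs_def
  set m : Fin N → ℕ := fun k => ⌊dist (x i) (x k) / r⌋₊ with hm
  set t := s.image m with ht_def
  have hmem : ∀ k ∈ s, m k ∈ t := fun k hk => Finset.mem_image_of_mem m hk
  have hks : ∀ k ∈ s, r ≤ dist (x i) (x k) := fun k hk =>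
    hsep i k (Finset.ne_of_mem_erase hk).symm
  have hm1 : ∀ k ∈ s, 1 ≤ m k := fun k hk =>
    (Nat.one_le_floor_iff _).2 ((one_le_div hr).2 (hks k hk))
  have hmle : ∀ k ∈ s, r * m k ≤ dist (x i) (x k) := fun k hk => by
    have := Nat.floor_le (div_nonneg dist_nonneg hr.le : 0 ≤ dist (x i) (x k) / r)
    rwa [le_div_iff₀ hr, mul_comm] at this
  have hmlt : ∀ k ∈ s, dist (x i) (x k) < (m k + 1) * r := fun k hk => by
    have := Nat.lt_floor_add_one (dist (x i) (x k) / r)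
    rwa [div_lt_iff₀ hr] at this
  -- termwise: `|xᵢ - x_k|⁻⁵ ≤ (r m_k)⁻⁵`
  have step1 : ∑ k ∈ s, (dist (x i) (x k))⁻¹ ^ 5 ≤ ∑ k ∈ s, r⁻¹ ^ 5 * ((m k : ℝ))⁻¹ ^ 5 := by
    refine Finset.sum_le_sum fun k hk => ?_
    rw [← mul_pow, ← mul_inv]
    have h0 : 0 < r * m k := mul_pos hr (by exact_mod_cast hm1 k hk)
    exact pow_le_pow_left₀ (inv_nonneg.2 dist_nonneg) (inv_anti₀ h0 (hmle k hk)) _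
  -- regroup by shells
  have step2 : ∑ k ∈ s, r⁻¹ ^ 5 * ((m k : ℝ))⁻¹ ^ 5 =
      ∑ b ∈ t, ((s.filter fun k => m k = b).card : ℝ) * (r⁻¹ ^ 5 * ((b : ℝ))⁻¹ ^ 5) := by
    have := Finset.sum_fiberwise_of_maps_to' hmem (fun b : ℕ => r⁻¹ ^ 5 * ((b : ℝ))⁻¹ ^ 5)
    simp only [Finset.sum_const, nsmul_eq_mul] at this
    exact this.symm
  -- each shell holds at most `(2b+3)³` particles
  have step3 : ∀ b ∈ t, ((s.filter fun k => m k = b).card : ℝ) ≤ (2 * (b : ℝ) + 3) ^ 3 := by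
    intro b hb
    set F := s.filter fun k => m k = b with hF
    have hinj : Set.InjOn x F := fun k _ l _ hkl => by
      by_contra hne
      have := hsep k l hne
      rw [hkl, dist_self] at this
      exact absurd this (not_le.2 hr)
    rw [← Finset.card_image_of_injOn hinj]
    have hR : (0 : ℝ) ≤ ((b : ℝ) + 1) * r := by positivity
    have := card_le_of_separated_of_dist_le (F.image x) (x i) hr hR ?_ ?_
    · rw [finrank_euclideanSpace_fin] at this
      convert this using 2
      field_simp
      ring
    · intro c hc
      obtain ⟨k, hk, rfl⟩ := Finset.mem_image.1 hc
      obtain ⟨hks', hkb⟩ := Finset.mem_filter.1 hk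
      rw [dist_comm]
      have := hmlt k hks'
      rw [hkb] at this
      exact this.le
    · intro c hc c' hc' hne
      obtain ⟨k, -, rfl⟩ := Finset.mem_image.1 hc
      obtain ⟨l, -, rfl⟩ := Finset.mem_image.1 hc'
      exact hsep k l fun h => hne (h ▸ rfl)
  -- numerics per shell: `(2b+3)³ b⁻⁵ ≤ 125 b⁻²` for `b ≥ 1`
  have step4 : ∀ b ∈ t, (2 * (b : ℝ) + 3) ^ 3 * (r⁻¹ ^ 5 * ((b : ℝ))⁻¹ ^ 5) ≤
      125 * r⁻¹ ^ 5 * ((b : ℝ) ^ 2)⁻¹ := by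
    intro b hb
    obtain ⟨k, hk, rfl⟩ := Finset.mem_image.1 hb
    have hb1 : (1 : ℝ) ≤ (m k : ℝ) := by exact_mod_cast hm1 k hk
    set β : ℝ := (m k : ℝ)
    have hβ : 0 < β := by linarith
    have hr5 : 0 < r⁻¹ ^ 5 := by positivity
    have key : (2 * β + 3) ^ 3 * (β⁻¹) ^ 5 ≤ 125 * (β ^ 2)⁻¹ := by
      rw [inv_pow, ← div_eq_mul_inv, ← div_eq_mul_inv,
        div_le_div_iff₀ (by positivity) (by positivity)]
      have h5 : (2 * β + 3) ^ 3 ≤ (5 * β) ^ 3 :=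
        pow_le_pow_left₀ (by positivity) (by linarith) 3
      nlinarith [mul_le_mul_of_nonneg_right h5 (sq_nonneg β)]
    calc (2 * β + 3) ^ 3 * (r⁻¹ ^ 5 * (β⁻¹) ^ 5) = r⁻¹ ^ 5 * ((2 * β + 3) ^ 3 * (β⁻¹) ^ 5) := by
          ring
      _ ≤ r⁻¹ ^ 5 * (125 * (β ^ 2)⁻¹) := mul_le_mul_of_nonneg_left key hr5.le
      _ = 125 * r⁻¹ ^ 5 * (β ^ 2)⁻¹ := by ring
  -- `∑_{b ∈ t} b⁻² ≤ 2`
  have step5 : ∑ b ∈ t, ((b : ℝ) ^ 2)⁻¹ ≤ 2 := by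
    have hsub : t ⊆ Finset.Ioo 0 (t.sup id + 1) := fun b hb => by
      rw [Finset.mem_Ioo]
      obtain ⟨k, hk, rfl⟩ := Finset.mem_image.1 hb
      exact ⟨hm1 k hk, Nat.lt_succ_of_le (Finset.le_sup (f := id) hb)⟩
    have h2 := sum_Ioo_inv_sq_le (α := ℝ) 0 (t.sup id + 1)
    calc ∑ b ∈ t, ((b : ℝ) ^ 2)⁻¹ ≤ ∑ b ∈ Finset.Ioo 0 (t.sup id + 1), ((b : ℝ) ^ 2)⁻¹ :=
          Finset.sum_le_sum_of_subset_of_nonneg hsub fun b _ _ => by positivity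
      _ ≤ 2 := by simpa using h2
  have hr5 : 0 ≤ r⁻¹ ^ 5 := by positivity
  calc ∑ k ∈ s, (dist (x i) (x k))⁻¹ ^ 5
      ≤ ∑ b ∈ t, ((s.filter fun k => m k = b).card : ℝ) * (r⁻¹ ^ 5 * ((b : ℝ))⁻¹ ^ 5) :=
        step1.trans_eq step2
    _ ≤ ∑ b ∈ t, (2 * (b : ℝ) + 3) ^ 3 * (r⁻¹ ^ 5 * ((b : ℝ))⁻¹ ^ 5) :=
        Finset.sum_le_sum fun b hb => mul_le_mul_of_nonneg_right (step3 b hb) (by positivity)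
    _ ≤ ∑ b ∈ t, 125 * r⁻¹ ^ 5 * ((b : ℝ) ^ 2)⁻¹ := Finset.sum_le_sum step4
    _ = 125 * r⁻¹ ^ 5 * ∑ b ∈ t, ((b : ℝ) ^ 2)⁻¹ := by rw [Finset.mul_sum]
    _ ≤ 125 * r⁻¹ ^ 5 * 2 := mul_le_mul_of_nonneg_left step5 (by positivity)
    _ = 250 * r⁻¹ ^ 5 := by ring

/-- **The far sixth-power sum decays.** If all mutual distances in `x` are `≥ r > 0` and
`T > 0`, then `∑_{k ≠ i, |xᵢ − x_k| ≥ T} |xᵢ − x_k|⁻⁶ ≤ 250 r⁻⁵ · T⁻¹`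
(`|xᵢ − x_k|⁻⁶ ≤ T⁻¹ |xᵢ − x_k|⁻⁵` on the far terms). [folklore] -/
theorem sum_inv_pow_six_far_le {N : ℕ} (x : Fin N → E3) {r : ℝ} (hr : 0 < r)
    (hsep : ∀ k l, k ≠ l → r ≤ dist (x k) (x l)) (i : Fin N) {T : ℝ} (hT : 0 < T) :
    ∑ k ∈ (Finset.univ.erase i).filter (fun k => T ≤ dist (x i) (x k)),
        (dist (x i) (x k))⁻¹ ^ 6 ≤ 250 * r⁻¹ ^ 5 * T⁻¹ := by
  have h5 := sum_inv_pow_five_le x hr hsep i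
  have hterm : ∀ k ∈ (Finset.univ.erase i).filter (fun k => T ≤ dist (x i) (x k)),
      (dist (x i) (x k))⁻¹ ^ 6 ≤ T⁻¹ * (dist (x i) (x k))⁻¹ ^ 5 := by
    intro k hk
    have hTk : T ≤ dist (x i) (x k) := (Finset.mem_filter.1 hk).2
    have hdk : 0 < dist (x i) (x k) := hT.trans_le hTk
    rw [pow_succ, mul_comm]
    exact mul_le_mul_of_nonneg_right (inv_anti₀ hT hTk) (by positivity)
  calc ∑ k ∈ (Finset.univ.erase i).filter (fun k => T ≤ dist (x i) (x k)),
        (dist (x i) (x k))⁻¹ ^ 6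
      ≤ ∑ k ∈ (Finset.univ.erase i).filter (fun k => T ≤ dist (x i) (x k)),
          T⁻¹ * (dist (x i) (x k))⁻¹ ^ 5 := Finset.sum_le_sum hterm
    _ ≤ ∑ k ∈ Finset.univ.erase i, T⁻¹ * (dist (x i) (x k))⁻¹ ^ 5 :=
        Finset.sum_le_sum_of_subset_of_nonneg (Finset.filter_subset _ _)
          fun k _ _ => by positivity
    _ = T⁻¹ * ∑ k ∈ Finset.univ.erase i, (dist (x i) (x k))⁻¹ ^ 5 := by rw [Finset.mul_sum]
    _ ≤ T⁻¹ * (250 * r⁻¹ ^ 5) := mul_le_mul_of_nonneg_left h5 (by positivity)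
    _ = 250 * r⁻¹ ^ 5 * T⁻¹ := by ring

/-! ## Separated nets and the packing count -/

/-- **A maximal separated sub-family is a net.** Given finitely many labels `G`, positions `p`
and a threshold `D`, there is a sub-family `T ⊆ G` whose positions are pairwise more than
`D` apart and such that every member of `G` is within `D` of some member of `T` (take a
`D`-separated sub-family of maximal cardinality). [folklore] -/
theorem exists_separated_net {α ι : Type*} [PseudoMetricSpace α] (G : Finset ι) (p : ι → α)
    {D : ℝ} (hD : 0 ≤ D) :
    ∃ T ⊆ G, (∀ a ∈ T, ∀ b ∈ T, a ≠ b → D < dist (p a) (p b)) ∧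
      ∀ g ∈ G, ∃ t ∈ T, dist (p g) (p t) ≤ D := by
  classical
  set fam : Finset (Finset ι) :=
    G.powerset.filter fun T => ∀ a ∈ T, ∀ b ∈ T, a ≠ b → D < dist (p a) (p b) with hfam
  have hne : fam.Nonempty := ⟨∅, by simp [hfam]⟩
  obtain ⟨T, hT, hmax⟩ := Finset.exists_max_image fam Finset.card hne
  obtain ⟨hTG, hTsep⟩ := Finset.mem_filter.1 hT
  rw [Finset.mem_powerset] at hTG
  refine ⟨T, hTG, hTsep, fun g hg => ?_⟩
  by_cases hgT : g ∈ T
  · exact ⟨g, hgT, by rw [dist_self]; exact hD⟩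
  by_contra hfar
  push Not at hfar
  have hins : insert g T ∈ fam := by
    refine Finset.mem_filter.2 ⟨Finset.mem_powerset.2 (Finset.insert_subset hg hTG), ?_⟩
    intro a ha b hb hab
    rw [Finset.mem_insert] at ha hb
    rcases ha with ha | ha
    · rcases hb with hb | hb
      · exact absurd (ha.trans hb.symm) hab
      · rw [ha]; exact hfar b hb
    · rcases hb with hb | hb
      · rw [hb, dist_comm]; exact hfar a ha
      · exact hTsep a ha b hb hab
  have := hmax _ hins
  rw [Finset.card_insert_of_notMem hgT] at this
  omega

/-- **Counting with a net.** If `T` is a `D`-net of `G` and every `D`-ball about a member of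
`T` contains at most `C` members of `G`, then `#G ≤ #T · C`. [folklore] -/
theorem card_le_card_net_mul {α ι : Type*} [PseudoMetricSpace α] {G T : Finset ι} (p : ι → α)
    {D C : ℝ} (hnet : ∀ g ∈ G, ∃ t ∈ T, dist (p g) (p t) ≤ D)
    (hball : ∀ t ∈ T, ((G.filter fun g => dist (p g) (p t) ≤ D).card : ℝ) ≤ C) :
    (G.card : ℝ) ≤ T.card * C := by
  classical
  have hsub : G ⊆ T.biUnion fun t => G.filter fun g => dist (p g) (p t) ≤ D := by
    intro g hg
    obtain ⟨t, ht, hgt⟩ := hnet g hg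
    exact Finset.mem_biUnion.2 ⟨t, ht, Finset.mem_filter.2 ⟨hg, hgt⟩⟩
  calc (G.card : ℝ) ≤ ((T.biUnion fun t => G.filter fun g => dist (p g) (p t) ≤ D).card : ℝ) := by
        exact_mod_cast Finset.card_le_card hsub
    _ ≤ ∑ t ∈ T, ((G.filter fun g => dist (p g) (p t) ≤ D).card : ℝ) := by
        exact_mod_cast Finset.card_biUnion_le
    _ ≤ ∑ _t ∈ T, C := Finset.sum_le_sum hball
    _ = T.card * C := by rw [Finset.sum_const, nsmul_eq_mul]

/-- **Balls of a separated configuration hold few particles**: if the mutual distances of the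
injective configuration `x` of `ℝ³` are `≥ r > 0`, then for `D ≥ 0` at most `(2D/r + 1)³`
indices of any index set `G` lie within `D` of `x i`. [folklore] -/
theorem card_ball_le_of_separated {N : ℕ} (x : Fin N → E3) {r : ℝ} (hr : 0 < r)
    (hsep : ∀ k l, k ≠ l → r ≤ dist (x k) (x l)) (G : Finset (Fin N)) (i : Fin N) {D : ℝ}
    (hD : 0 ≤ D) :
    ((G.filter fun g => dist (x g) (x i) ≤ D).card : ℝ) ≤ (2 * D / r + 1) ^ 3 := by
  classical
  set F := G.filter fun g => dist (x g) (x i) ≤ D with hF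
  have hinj : Set.InjOn x F := fun k _ l _ hkl => by
    by_contra hne
    have := hsep k l hne
    rw [hkl, dist_self] at this
    exact absurd this (not_le.2 hr)
  rw [← Finset.card_image_of_injOn hinj]
  have := card_le_of_separated_of_dist_le (F.image x) (x i) hr hD ?_ ?_
  · rwa [finrank_euclideanSpace_fin] at this
  · intro c hc
    obtain ⟨k, hk, rfl⟩ := Finset.mem_image.1 hc
    exact (Finset.mem_filter.1 hk).2
  · intro c hc c' hc' hne
    obtain ⟨k, -, rfl⟩ := Finset.mem_image.1 hc
    obtain ⟨l, -, rfl⟩ := Finset.mem_image.1 hc'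
    exact hsep k l fun h => hne (h ▸ rfl)

end Summit.AtomisticToContinuum.Crystallization.Theorems.ChargedPeriodicOptimal

end
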